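import Mathlib
import Literature.Algebra.Polynomial.RealRootedFarDifferences
import HarnessLib

/-!
# Binomial smoothing profiles: `j ↦ E[φ(s₀ − j + Bin(2j+1, ½))]` and their exact forward differences

For a kernel `φ : ℤ → ℝ`, an integer `s` and `c ∈ ℕ` write
`T_c φ (s) = Σ_{w=0}^{c} C(c,w) 2^{−c} φ(s + w) = E[φ(s + Bin(c,½))]` (a plain `Finset.sum`; no definition is
introduced). The **binomial smoothing profile** of `φ` based at `s₀` is `j ↦ T_{2j+1} φ (s₀ − j)`: the number of
`±½`-steps grows by two while the base point drops by one, so that the mean `s₀ − j + (2j+1)/2 = s₀ + ½` is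
constant. This is the level structure of the shell law of a block statistic for a block WITHOUT internal matching
edges (cell pnp-psdrank, eng MEMO-22 §6 (K1)–(K3): for a perfect matching of `H`-type `(0,b,d)` the law of
`|U ∩ H|` on the shell of level `c` and cut `t` is `T_c φ_y ((t−c)/2)` with the hypergeometric kernel
`φ_y(K) = C(K,y)C(N−K,b−y)/C(N,b)` in the POPULATION parameter `K`); here only the elementary operator calculus
is recorded, for an arbitrary kernel:

* `binomialAvg_succ` — ONE PASCAL STEP: `T_{c+1} φ (s) = (T_c φ (s) + T_c φ (s+1))/2`.
* `binomialAvg_succ_succ` — TWO STEPS: `T_{c+2} φ (s−1) = T_c (Bφ)(s)` with the binomial smoothing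
  `(Bφ)(K) = (φ(K−1) + 2φ(K) + φ(K+1))/4 = φ(K) + ¼(∇²φ)(K)`.
* `fwdDiff_binomialProfile` — THE EXACT HEAT EQUATION OF THE PROFILE: `Δ_j [T_{2j+1} φ (s₀ − j)] =
  T_{2j+1} (¼∇²φ)(s₀ − j)`, and iterated (`fwdDiff_iter_binomialProfile`)
  `Δ^k_j [T_{2j+1} φ (s₀ − j)] = T_{2j+1} ((¼∇²)^k φ)(s₀ − j)`: the `k`-fold difference of the profile in the
  LEVEL index is one `2k`-fold central difference of the kernel, averaged — no signed families, no deletions.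
* `abs_fwdDiff_iter_binomialProfile_zero_le` — transfer of a pointwise relative bound: if
  `|((¼∇²)^k φ)(K)| ≤ ρ·φ(K)` at the two points `K ∈ {s₀, s₀+1}` then `|Δ^k_j[…](0)| ≤ ρ·T_1 φ (s₀)`; and the
  weighted form `sum_mul_abs_fwdDiff_iter_binomialProfile_zero_le` (`Σ_k a_k|Δ^k(0)| ≤ (Σ_k a_k ρ_k)·T_1 φ(s₀)` for
  `a_k ≥ 0`), which is the shape of the virtual-positivity criterion of the cell's Theorems brick
  `ChebyshevTracialDesignVirtualPositivityCriterion` (`Σ_k (C(2k,k)/4^k)|Δ^k law| ≤ law₁`).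
* (v2) §4 `laplaceQuarter_iter_eq_fwdDiff_iter` (`L^k = 4^{−k}·T_{−k}Δ₁^{2k}`) and `fwdDiff_iter_intCast_comp`
  (`ℤ`-indexed differences of `g ∘ (↑)` are the real differences of `g`); §5 `hypergeomPopulationKernel_eq_prod`
  (THE HYPERGEOMETRIC LAW IN ITS POPULATION PARAMETER IS A PRODUCT OF `b` LINEAR FACTORS:
  `C(b,y)C(N−b,K−y)/C(N,K) = C(b,y)(−1)^{b−y}/(N)_b · Π_{i<y}(K−i)·Π_{j<b−y}(K−(N−j))` for `y ≤ b ≤ K ≤ N−b`) and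
  `abs_laplaceQuarter_iter_prodKernel_le` (for a kernel `c·Π_{i<b}(K − r_i)` and `|K₁ − r_i| ≥ R + 3k`:
  `|(L^kφ)(K₁)| ≤ 4^{−k}(b/R)^{2k}e^{3bk/R}|φ(K₁)|`, by `Literature.Algebra.Polynomial.RealRootedFarDifferences`).

All PROVED, 0 sorry, no definitions, no named facts. Folklore operator calculus (Pascal's rule; the random walk
`Bin(c+2,½) − 1 = Bin(c,½) + Z`, `Z ∈ {−1,0,1}` with weights `¼,½,¼`); instrument/support material for the OPEN
crux `TracialDecayExp20` of route `ChebyshevTracialDesign` — nothing here is a statement about that crux, about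
psd rank, or about P vs NP.

## References
* [Feller1968] W. Feller, *An Introduction to Probability Theory and Its Applications*, Vol. I, 3rd ed. (1968),
  Ch. II §12 (identities for binomial coefficients: Pascal's rule, Vandermonde) and Ch. III §2 (the symmetric random
  walk: `Bin(c,½)` as the position after `c` fair steps; one more pair of steps is the `¼,½,¼` smoothing).
* [Rothvoss2017] T. Rothvoß, *The matching polytope has exponential extension complexity*, J. ACM 64 (2017),
  §2 (PDF pp. 5–6): cuts, their partition by a perfect matching, the level classes.
-/

noncomputable section

open Finset

namespace Literature.Probability.Distributions

namespace BinomialSmoothing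

/-! ### §1 One and two Pascal steps -/

/-- **One Pascal step**: `Σ_{w≤c+1} C(c+1,w) φ(s+w) = Σ_{w≤c} C(c,w) φ(s+w) + Σ_{w≤c} C(c,w) φ(s+w+1)`
(Pascal's rule `C(c+1,w) = C(c,w) + C(c,w−1)` summed against `φ`). [cite: Feller1968, Ch. II §12 (identities for binomial coefficients)] -/
theorem sum_choose_succ_mul (φ : ℤ → ℝ) (c : ℕ) (s : ℤ) :
    ∑ w ∈ range (c + 2), ((c + 1).choose w : ℝ) * φ (s + w) =
      ∑ w ∈ range (c + 1), (c.choose w : ℝ) * φ (s + w) +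
        ∑ w ∈ range (c + 1), (c.choose w : ℝ) * φ (s + (w + 1)) := by
  -- peel off `w = 0` on the left and use Pascal `C(c+1,w+1) = C(c,w) + C(c,w+1)`
  have hL : ∑ w ∈ range (c + 2), ((c + 1).choose w : ℝ) * φ (s + w) =
      φ s + ∑ w ∈ range (c + 1), (((c.choose w : ℝ) + (c.choose (w + 1) : ℝ)) * φ (s + (w + 1))) := by
    rw [sum_range_succ' (fun w => ((c + 1).choose w : ℝ) * φ (s + w)) (c + 1)]
    simp only [Nat.choose_zero_right, Nat.cast_one, one_mul, Nat.cast_zero, add_zero, add_comm (φ s)]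
    congr 1
    refine sum_congr rfl fun w _ => ?_
    rw [Nat.choose_succ_succ', Nat.cast_add]
    push_cast
    ring_nf
  -- the `C(c,w+1)`-part re-indexes to `Σ_{w≤c} C(c,w) φ(s+w) − φ(s)` (top term `C(c,c+1) = 0`)
  have hR : ∑ w ∈ range (c + 1), (c.choose (w + 1) : ℝ) * φ (s + (w + 1)) + φ s =
      ∑ w ∈ range (c + 1), (c.choose w : ℝ) * φ (s + w) := by
    have e := sum_range_succ' (fun w => (c.choose w : ℝ) * φ (s + w)) (c + 1)
    simp only [Nat.choose_zero_right, Nat.cast_one, one_mul, Nat.cast_zero, add_zero] at e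
    rw [sum_range_succ, Nat.choose_succ_self, Nat.cast_zero, zero_mul, add_zero] at e
    rw [e]
    congr 1
  rw [hL, ← hR]
  simp only [add_mul, sum_add_distrib]
  ring

/-- **The binomial average after one Pascal step**:
`Σ_{w≤c+1} C(c+1,w)2^{−(c+1)} φ(s+w) = ½(Σ_{w≤c} C(c,w)2^{−c} φ(s+w) + Σ_{w≤c} C(c,w)2^{−c} φ(s+1+w))`.
[cite: Feller1968, Ch. III §2 (the symmetric random walk)] -/
theorem binomialAvg_succ (φ : ℤ → ℝ) (c : ℕ) (s : ℤ) :
    ∑ w ∈ range (c + 2), ((c + 1).choose w : ℝ) / 2 ^ (c + 1) * φ (s + w) =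
      (∑ w ∈ range (c + 1), (c.choose w : ℝ) / 2 ^ c * φ (s + w) +
        ∑ w ∈ range (c + 1), (c.choose w : ℝ) / 2 ^ c * φ (s + 1 + w)) / 2 := by
  have h := sum_choose_succ_mul φ c s
  have e1 : ∑ w ∈ range (c + 2), ((c + 1).choose w : ℝ) / 2 ^ (c + 1) * φ (s + w) =
      (∑ w ∈ range (c + 2), ((c + 1).choose w : ℝ) * φ (s + w)) / 2 ^ (c + 1) := by
    rw [sum_div]; refine sum_congr rfl fun w _ => ?_; ring
  have e2 : ∑ w ∈ range (c + 1), (c.choose w : ℝ) / 2 ^ c * φ (s + w) =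
      (∑ w ∈ range (c + 1), (c.choose w : ℝ) * φ (s + w)) / 2 ^ c := by
    rw [sum_div]; refine sum_congr rfl fun w _ => ?_; ring
  have e3 : ∑ w ∈ range (c + 1), (c.choose w : ℝ) / 2 ^ c * φ (s + 1 + w) =
      (∑ w ∈ range (c + 1), (c.choose w : ℝ) * φ (s + (w + 1))) / 2 ^ c := by
    rw [sum_div]; refine sum_congr rfl fun w _ => ?_; rw [show s + 1 + (w : ℤ) = s + (w + 1) by ring]; ring
  rw [e1, e2, e3, h, pow_succ]
  field_simp

/-- **Two Pascal steps = one binomial smoothing of the kernel**: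
`Σ_{w≤c+2} C(c+2,w)2^{−(c+2)} φ(s−1+w) = Σ_{w≤c} C(c,w)2^{−c}·(φ(s+w−1) + 2φ(s+w) + φ(s+w+1))/4` — the law
`Bin(c+2,½) − 1` is `Bin(c,½) + Z` with `Z ∈ {−1,0,1}` of weights `¼, ½, ¼`. [cite: Feller1968, Ch. III §2 (the symmetric random walk)] -/
theorem binomialAvg_succ_succ (φ : ℤ → ℝ) (c : ℕ) (s : ℤ) :
    ∑ w ∈ range (c + 3), ((c + 2).choose w : ℝ) / 2 ^ (c + 2) * φ (s - 1 + w) =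
      ∑ w ∈ range (c + 1), (c.choose w : ℝ) / 2 ^ c *
        ((φ (s + w - 1) + 2 * φ (s + w) + φ (s + w + 1)) / 4) := by
  rw [binomialAvg_succ φ (c + 1) (s - 1), binomialAvg_succ φ c (s - 1),
    show s - 1 + 1 = s by ring, binomialAvg_succ φ c s]
  have e1 : ∑ w ∈ range (c + 1), (c.choose w : ℝ) / 2 ^ c * φ (s - 1 + w) =
      ∑ w ∈ range (c + 1), (c.choose w : ℝ) / 2 ^ c * φ (s + w - 1) := by
    refine sum_congr rfl fun w _ => ?_; rw [show s - 1 + (w : ℤ) = s + w - 1 by ring]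
  have e2 : ∑ w ∈ range (c + 1), (c.choose w : ℝ) / 2 ^ c * φ (s + 1 + w) =
      ∑ w ∈ range (c + 1), (c.choose w : ℝ) / 2 ^ c * φ (s + w + 1) := by
    refine sum_congr rfl fun w _ => ?_; rw [show s + 1 + (w : ℤ) = s + w + 1 by ring]
  rw [e1, e2]
  have e3 : ∑ w ∈ range (c + 1), (c.choose w : ℝ) / 2 ^ c *
      ((φ (s + w - 1) + 2 * φ (s + w) + φ (s + w + 1)) / 4) =
      ∑ w ∈ range (c + 1), ((c.choose w : ℝ) / 2 ^ c * φ (s + w - 1) / 4 +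
        ((c.choose w : ℝ) / 2 ^ c * φ (s + w) / 2 + (c.choose w : ℝ) / 2 ^ c * φ (s + w + 1) / 4)) := by
    refine sum_congr rfl fun w _ => ?_; ring
  rw [e3, sum_add_distrib, sum_add_distrib, ← sum_div, ← sum_div, ← sum_div]
  ring

/-! ### §2 The exact heat equation of the binomial smoothing profile -/

/-- **One level step is one quarter Laplacian**: for the profile `P_φ(j) = Σ_{w≤2j+1} C(2j+1,w)2^{−(2j+1)} φ(s₀−j+w)`,
`P_φ(j+1) − P_φ(j) = P_{Lφ}(j)` with `(Lφ)(K) = (φ(K−1) − 2φ(K) + φ(K+1))/4`. [cite: Feller1968, Ch. III §2 (the symmetric random walk)] -/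
theorem fwdDiff_binomialProfile (φ : ℤ → ℝ) (s₀ : ℤ) (j : ℕ) :
    fwdDiff (1 : ℕ) (fun j : ℕ => ∑ w ∈ range (2 * j + 2), ((2 * j + 1).choose w : ℝ) / 2 ^ (2 * j + 1) *
        φ (s₀ - j + w)) j =
      ∑ w ∈ range (2 * j + 2), ((2 * j + 1).choose w : ℝ) / 2 ^ (2 * j + 1) *
        (fun K : ℤ => (φ (K - 1) - 2 * φ K + φ (K + 1)) / 4) (s₀ - j + w) := by
  rw [fwdDiff]
  have e : ∑ w ∈ range (2 * (j + 1) + 2), ((2 * (j + 1) + 1).choose w : ℝ) / 2 ^ (2 * (j + 1) + 1) *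
      φ (s₀ - ((j + 1 : ℕ) : ℤ) + w) =
      ∑ w ∈ range ((2 * j + 1) + 3), (((2 * j + 1) + 2).choose w : ℝ) / 2 ^ ((2 * j + 1) + 2) *
        φ ((s₀ - j) - 1 + w) := by
    rw [show 2 * (j + 1) + 2 = (2 * j + 1) + 3 by ring, show 2 * (j + 1) + 1 = (2 * j + 1) + 2 by ring]
    refine sum_congr rfl fun w _ => ?_
    push_cast; ring_nf
  rw [e, binomialAvg_succ_succ φ (2 * j + 1) (s₀ - j), ← sum_sub_distrib]
  refine sum_congr rfl fun w _ => ?_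
  simp only
  ring

/-- **The iterated heat equation**: `Δ^k_j P_φ(j) = P_{L^k φ}(j)`, `L = ¼∇²` — the `k`-fold forward difference of the
binomial smoothing profile in the level index is the binomial average of ONE `2k`-fold central difference of the
kernel. [cite: Feller1968, Ch. III §2 (the symmetric random walk)] -/
theorem fwdDiff_iter_binomialProfile (k : ℕ) : ∀ (φ : ℤ → ℝ) (s₀ : ℤ) (j : ℕ),
    (fwdDiff (1 : ℕ))^[k] (fun j : ℕ => ∑ w ∈ range (2 * j + 2), ((2 * j + 1).choose w : ℝ) / 2 ^ (2 * j + 1) *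
        φ (s₀ - j + w)) j =
      ∑ w ∈ range (2 * j + 2), ((2 * j + 1).choose w : ℝ) / 2 ^ (2 * j + 1) *
        ((fun ψ : ℤ → ℝ => fun K : ℤ => (ψ (K - 1) - 2 * ψ K + ψ (K + 1)) / 4)^[k] φ) (s₀ - j + w) := by
  induction k with
  | zero => intro φ s₀ j; simp
  | succ k ih =>
    intro φ s₀ j
    rw [Function.iterate_succ_apply, Function.iterate_succ_apply]
    -- `Δ^[k] (Δ P_φ) = Δ^[k] P_{Lφ}` since `Δ P_φ = P_{Lφ}` as functions
    have hfun : fwdDiff (1 : ℕ) (fun j : ℕ => ∑ w ∈ range (2 * j + 2),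
        ((2 * j + 1).choose w : ℝ) / 2 ^ (2 * j + 1) * φ (s₀ - j + w)) =
        fun j : ℕ => ∑ w ∈ range (2 * j + 2), ((2 * j + 1).choose w : ℝ) / 2 ^ (2 * j + 1) *
          (fun K : ℤ => (φ (K - 1) - 2 * φ K + φ (K + 1)) / 4) (s₀ - j + w) := by
      funext j'; exact fwdDiff_binomialProfile φ s₀ j'
    rw [hfun]
    exact ih (fun K : ℤ => (φ (K - 1) - 2 * φ K + φ (K + 1)) / 4) s₀ j

/-! ### §3 Transfer of pointwise relative kernel bounds to the profile at `j = 0` -/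

/-- The profile at `j = 0` is the two-point average `(φ(s₀) + φ(s₀+1))/2` (one fair `±½` step).
[cite: Feller1968, Ch. III §2 (the symmetric random walk)] -/
theorem binomialProfile_zero (φ : ℤ → ℝ) (s₀ : ℤ) :
    (fun j : ℕ => ∑ w ∈ range (2 * j + 2), ((2 * j + 1).choose w : ℝ) / 2 ^ (2 * j + 1) *
        φ (s₀ - j + w)) 0 = (φ s₀ + φ (s₀ + 1)) / 2 := by
  simp [sum_range_succ]
  ring

/-- **Transfer of a pointwise relative bound.** If the kernel is nonnegative at `s₀, s₀+1` and its `k`-fold quarter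
Laplacian satisfies `|(L^k φ)(K)| ≤ ρ·φ(K)` at these two points, then `|Δ^k_j P_φ(0)| ≤ ρ·P_φ(0)`.
[cite: Feller1968, Ch. III §2 (the symmetric random walk)] -/
theorem abs_fwdDiff_iter_binomialProfile_zero_le (φ : ℤ → ℝ) (s₀ : ℤ) (k : ℕ) {ρ : ℝ}
    (hbd : ∀ K ∈ ({s₀, s₀ + 1} : Finset ℤ),
      |((fun ψ : ℤ → ℝ => fun K : ℤ => (ψ (K - 1) - 2 * ψ K + ψ (K + 1)) / 4)^[k] φ) K| ≤ ρ * φ K) :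
    |(fwdDiff (1 : ℕ))^[k] (fun j : ℕ => ∑ w ∈ range (2 * j + 2), ((2 * j + 1).choose w : ℝ) / 2 ^ (2 * j + 1) *
        φ (s₀ - j + w)) 0| ≤
      ρ * ((fun j : ℕ => ∑ w ∈ range (2 * j + 2), ((2 * j + 1).choose w : ℝ) / 2 ^ (2 * j + 1) *
        φ (s₀ - j + w)) 0) := by
  rw [fwdDiff_iter_binomialProfile k φ s₀ 0, binomialProfile_zero]
  have h0 := hbd s₀ (by simp)
  have h1 := hbd (s₀ + 1) (by simp)
  simp only [mul_zero, Nat.cast_zero, sub_zero, sum_range_succ, sum_range_zero, zero_add, Nat.choose_zero_right,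
    Nat.cast_one, pow_one, add_zero, Nat.choose_one_right] at *
  have e : ∀ a b : ℝ, (1 : ℝ) / 2 * a + 1 / 2 * b = (a + b) / 2 := fun a b => by ring
  rw [e]
  calc |(((fun ψ : ℤ → ℝ => fun K : ℤ => (ψ (K - 1) - 2 * ψ K + ψ (K + 1)) / 4)^[k] φ) s₀ +
        ((fun ψ : ℤ → ℝ => fun K : ℤ => (ψ (K - 1) - 2 * ψ K + ψ (K + 1)) / 4)^[k] φ) (s₀ + 1)) / 2|
      ≤ (|((fun ψ : ℤ → ℝ => fun K : ℤ => (ψ (K - 1) - 2 * ψ K + ψ (K + 1)) / 4)^[k] φ) s₀| +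
          |((fun ψ : ℤ → ℝ => fun K : ℤ => (ψ (K - 1) - 2 * ψ K + ψ (K + 1)) / 4)^[k] φ) (s₀ + 1)|) / 2 := by
        rw [abs_div, abs_two]
        exact div_le_div_of_nonneg_right (abs_add_le _ _) (by norm_num)
    _ ≤ (ρ * φ s₀ + ρ * φ (s₀ + 1)) / 2 := by gcongr
    _ = ρ * ((φ s₀ + φ (s₀ + 1)) / 2) := by ring

/-- **The criterion shape.** For nonnegative weights `a_k` and pointwise relative bounds `|(L^k φ)(K)| ≤ ρ_k φ(K)` at
`K ∈ {s₀, s₀+1}` for `1 ≤ k ≤ D`: `Σ_{k=1}^{D} a_k·|Δ^k_j P_φ(0)| ≤ (Σ_{k=1}^{D} a_k ρ_k)·P_φ(0)`.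
[cite: Feller1968, Ch. III §2 (the symmetric random walk)] -/
theorem sum_mul_abs_fwdDiff_iter_binomialProfile_zero_le (φ : ℤ → ℝ) (s₀ : ℤ) (D : ℕ) (a ρ : ℕ → ℝ)
    (ha : ∀ k, 0 ≤ a k)
    (hbd : ∀ k ∈ Ico 1 (D + 1), ∀ K ∈ ({s₀, s₀ + 1} : Finset ℤ),
      |((fun ψ : ℤ → ℝ => fun K : ℤ => (ψ (K - 1) - 2 * ψ K + ψ (K + 1)) / 4)^[k] φ) K| ≤ ρ k * φ K) :
    ∑ k ∈ Ico 1 (D + 1), a k *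
        |(fwdDiff (1 : ℕ))^[k] (fun j : ℕ => ∑ w ∈ range (2 * j + 2),
          ((2 * j + 1).choose w : ℝ) / 2 ^ (2 * j + 1) * φ (s₀ - j + w)) 0| ≤
      (∑ k ∈ Ico 1 (D + 1), a k * ρ k) *
        ((fun j : ℕ => ∑ w ∈ range (2 * j + 2), ((2 * j + 1).choose w : ℝ) / 2 ^ (2 * j + 1) *
          φ (s₀ - j + w)) 0) := by
  rw [sum_mul]
  refine sum_le_sum fun k hk => ?_
  rw [mul_assoc]
  exact mul_le_mul_of_nonneg_left (abs_fwdDiff_iter_binomialProfile_zero_le φ s₀ k (hbd k hk)) (ha k)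

/-! ### §4 (v2) The iterated quarter Laplacian as a shifted `2k`-fold forward difference; `ℤ`- versus `ℝ`-indexed differences -/

/-- `Δ₁² g (y) = g(y+2) − 2g(y+1) + g(y)` on `ℤ`. [cite: Feller1968, Ch. III §2 (the symmetric random walk)] -/
theorem fwdDiff_iter_two_apply (g : ℤ → ℝ) (y : ℤ) :
    (fwdDiff (1 : ℤ))^[2] g y = g (y + 2) - 2 * g (y + 1) + g y := by
  simp only [Function.iterate_succ, Function.iterate_zero, Function.comp_apply, fwdDiff, id_eq]
  ring_nf

/-- **`L^k = 4^{−k}·T_{−k}Δ₁^{2k}`**: the `k`-fold quarter Laplacian `(Lψ)(K) = (ψ(K−1) − 2ψ(K) + ψ(K+1))/4` is the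
`2k`-fold forward difference started `k` steps to the left, divided by `4^k`.
[cite: Feller1968, Ch. III §2 (the symmetric random walk)] -/
theorem laplaceQuarter_iter_eq_fwdDiff_iter (φ : ℤ → ℝ) (k : ℕ) : ∀ K : ℤ,
    ((fun ψ : ℤ → ℝ => fun K : ℤ => (ψ (K - 1) - 2 * ψ K + ψ (K + 1)) / 4)^[k] φ) K =
      (1 / 4 : ℝ) ^ k * (fwdDiff (1 : ℤ))^[2 * k] φ (K - k) := by
  induction k with
  | zero => intro K; simp
  | succ k ih =>
    intro K
    rw [Function.iterate_succ_apply', ih (K - 1), ih K, ih (K + 1),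
      show 2 * (k + 1) = 2 + 2 * k by ring, Function.iterate_add_apply, fwdDiff_iter_two_apply]
    push_cast
    rw [show K - 1 - (k : ℤ) = K - (k + 1) by ring, show K - (k : ℤ) = K - (k + 1) + 1 by ring,
      show K + 1 - (k : ℤ) = K - (k + 1) + 2 by ring]
    ring

/-- **`ℤ`-indexed differences of a real function are its real differences**: for `g : ℝ → ℝ`,
`Δ₁^m (g ∘ (↑)) (K) = Δ₁^m g (↑K)`. [cite: Feller1968, Ch. III §2 (the symmetric random walk)] -/
theorem fwdDiff_iter_intCast_comp (g : ℝ → ℝ) (m : ℕ) (K : ℤ) :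
    (fwdDiff (1 : ℤ))^[m] (fun L : ℤ => g (L : ℝ)) K = (fwdDiff (1 : ℝ))^[m] g (K : ℝ) := by
  rw [fwdDiff_iter_eq_sum_shift, fwdDiff_iter_eq_sum_shift]
  refine sum_congr rfl fun i _ => ?_
  push_cast
  simp [nsmul_eq_mul]

/-! ### §5 (v2) The hypergeometric law as a polynomial in its POPULATION parameter, and its far-roots smoothness -/

/-- **The hypergeometric population kernel is a product of `b` linear factors.** For `y ≤ b ≤ K ≤ N − b`:
`C(b,y)·C(N−b,K−y)/C(N,K) = C(b,y)·(−1)^{b−y}/(N)_b · Π_{i<y}(K − i) · Π_{j<b−y}(K − (N − j))`, written as one product over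
`i < b` with roots `r_i = i` (`i < y`) and `r_i = N − (i − y)` (`y ≤ i < b`) — the law of the number of marked
elements in a uniform `K`-subset of `[N]` with `b` marked, as a function of `K`.
[cite: ChattamvelliShanmugam2020, §7.4 Table 7.1 (hypergeometric law)] [cite: VatutinMikhailov1983, §2] -/
theorem hypergeomPopulationKernel_eq_prod {N b y K : ℕ} (hy : y ≤ b) (hbK : b ≤ K) (hKN : K + b ≤ N) :
    ((b.choose y * (N - b).choose (K - y) : ℕ) : ℝ) / N.choose K =
      ((b.choose y : ℕ) : ℝ) * (-1) ^ (b - y) / N.descFactorial b *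
        ∏ i ∈ range b, ((K : ℝ) - (fun i : ℕ => if i < y then (i : ℝ) else (N : ℝ) - ((i - y : ℕ) : ℝ)) i) := by
  -- the product splits as `Π_{i<y}(K − i) · Π_{j<b−y}(K − (N − j))`
  have hsplit : ∏ i ∈ range b, ((K : ℝ) - (fun i : ℕ => if i < y then (i : ℝ) else (N : ℝ) - ((i - y : ℕ) : ℝ)) i) =
      (∏ i ∈ range y, ((K : ℝ) - i)) * ∏ j ∈ range (b - y), ((K : ℝ) - ((N : ℝ) - j)) := by
    rw [← Nat.add_sub_cancel' hy, prod_range_add, Nat.add_sub_cancel' hy]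
    congr 1
    · refine prod_congr rfl fun i hi => ?_
      rw [mem_range] at hi; simp [hi]
    · refine prod_congr rfl fun j _ => ?_
      have hj : ¬ (y + j < y) := by omega
      simp [hj]
  rw [hsplit]
  -- the two products are descending factorials
  have h1 : ∏ i ∈ range y, ((K : ℝ) - i) = (K.descFactorial y : ℝ) := by
    rw [← descPochhammer_eval_eq_descFactorial ℝ K y, descPochhammer_eval_eq_prod_range]
  have h2 : (-1 : ℝ) ^ (b - y) * ∏ j ∈ range (b - y), ((K : ℝ) - ((N : ℝ) - j)) =
      ((N - K).descFactorial (b - y) : ℝ) := by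
    rw [← descPochhammer_eval_eq_descFactorial ℝ (N - K) (b - y), descPochhammer_eval_eq_prod_range]
    have e : ∏ j ∈ range (b - y), ((K : ℝ) - ((N : ℝ) - j)) = ∏ j ∈ range (b - y), -((((N - K : ℕ) : ℝ)) - j) := by
      refine prod_congr rfl fun j _ => ?_
      push_cast [Nat.cast_sub (show K ≤ N by omega)]
      ring
    rw [e, prod_neg, card_range, ← mul_assoc, ← mul_pow]
    norm_num
  -- move the sign next to the second product and substitute the two descending factorials
  have e0 : ((b.choose y : ℕ) : ℝ) * (-1) ^ (b - y) / N.descFactorial b *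
      ((∏ i ∈ range y, ((K : ℝ) - i)) * ∏ j ∈ range (b - y), ((K : ℝ) - ((N : ℝ) - j))) =
      ((b.choose y : ℕ) : ℝ) / N.descFactorial b * (∏ i ∈ range y, ((K : ℝ) - i)) *
        ((-1) ^ (b - y) * ∏ j ∈ range (b - y), ((K : ℝ) - ((N : ℝ) - j))) := by ring
  rw [e0, h1, h2]
  -- factorial bookkeeping: everything in terms of factorials
  have hKy : y ≤ K := hy.trans hbK
  have hby : b - y ≤ N - K := by omega
  have hfK := Nat.factorial_mul_descFactorial hKy            -- (K-y)! * K.descFactorial y = K!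
  have hfNK := Nat.factorial_mul_descFactorial hby          -- (N-K-(b-y))! * (N-K).descFactorial (b-y) = (N-K)!
  have hfN := Nat.factorial_mul_descFactorial (show b ≤ N by omega)  -- (N-b)! * N.descFactorial b = N!
  have hcK : (N.choose K : ℝ) = N.factorial / (K.factorial * (N - K).factorial) :=
    Nat.cast_choose ℝ (show K ≤ N by omega)
  have hcNb : ((N - b).choose (K - y) : ℝ) = (N - b).factorial / ((K - y).factorial * (N - b - (K - y)).factorial) :=
    Nat.cast_choose ℝ (show K - y ≤ N - b by omega)
  have hsame : N - b - (K - y) = N - K - (b - y) := by omega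
  rw [hsame] at hcNb
  have hfK' : ((K - y).factorial : ℝ) * (K.descFactorial y : ℝ) = K.factorial := by exact_mod_cast hfK
  have hfNK' : ((N - K - (b - y)).factorial : ℝ) * ((N - K).descFactorial (b - y) : ℝ) = (N - K).factorial := by
    exact_mod_cast hfNK
  have hfN' : ((N - b).factorial : ℝ) * (N.descFactorial b : ℝ) = N.factorial := by exact_mod_cast hfN
  have hKy0 : ((K - y).factorial : ℝ) ≠ 0 := by positivity
  have hr0 : ((N - K - (b - y)).factorial : ℝ) ≠ 0 := by positivity
  have hNb0 : ((N - b).factorial : ℝ) ≠ 0 := by positivity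
  have eK : (K.descFactorial y : ℝ) = K.factorial / (K - y).factorial := by
    rw [eq_div_iff hKy0]; linarith [hfK']
  have eNK : ((N - K).descFactorial (b - y) : ℝ) = (N - K).factorial / (N - K - (b - y)).factorial := by
    rw [eq_div_iff hr0]; linarith [hfNK']
  have eN : (N.descFactorial b : ℝ) = N.factorial / (N - b).factorial := by
    rw [eq_div_iff hNb0]; linarith [hfN']
  push_cast
  rw [hcK, hcNb, eK, eNK, eN]
  field_simp

/-- **Far-roots smoothness of a kernel of product form**, in the quarter-Laplacian currency of §2–§3: for
`φ(K) = c·Π_{i<b}(K − r_i)` (as a function on `ℤ`) and a point `K₁` with `|K₁ − r_i| ≥ R + 3k` for all `i < b` (`R > 0`):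
`|(L^k φ)(K₁)| ≤ 4^{−k}·(b/R)^{2k}·e^{3bk/R}·|φ(K₁)|` — `L^k = 4^{−k}T_{−k}Δ₁^{2k}` (§4),
`RealRootedFarDifferences.abs_fwdDiff_iter_eval_const_mul_prod_le` at the base point `K₁ − k`, and
`abs_eval_prod_le_exp_mul` to return to `K₁`. [cite: Agarwal2000DifferenceEquations, Remark 1.8.1]
[cite: Feller1968, Ch. III §2 (the symmetric random walk)] -/
theorem abs_laplaceQuarter_iter_prodKernel_le (r : ℕ → ℝ) (b k : ℕ) (c : ℝ) {R : ℝ} (hR : 0 < R)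
    (φ : ℤ → ℝ) (hφ : ∀ K : ℤ, φ K = c * (∏ i ∈ range b, (Polynomial.X - Polynomial.C (r i))).eval (K : ℝ)) (K₁ : ℤ)
    (hfar : ∀ i, i < b → R + 3 * k ≤ |(K₁ : ℝ) - r i|) :
    |((fun ψ : ℤ → ℝ => fun K : ℤ => (ψ (K - 1) - 2 * ψ K + ψ (K + 1)) / 4)^[k] φ) K₁| ≤
      (1 / 4 : ℝ) ^ k * (((b : ℝ) / R) ^ (2 * k) * Real.exp (b * (2 * k : ℕ) / R)) * Real.exp (b * k / R) *
        |φ K₁| := by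
  have hφfun : φ = fun K : ℤ => c * (∏ i ∈ range b, (Polynomial.X - Polynomial.C (r i))).eval (K : ℝ) := by
    funext K; exact hφ K
  have hT : (fwdDiff (1 : ℤ))^[2 * k]
      (fun K : ℤ => c * (∏ i ∈ range b, (Polynomial.X - Polynomial.C (r i))).eval (K : ℝ)) (K₁ - k) =
      (fwdDiff (1 : ℝ))^[2 * k]
        (fun z : ℝ => c * (∏ i ∈ range b, (Polynomial.X - Polynomial.C (r i))).eval z) (((K₁ - k : ℤ)) : ℝ) :=
    fwdDiff_iter_intCast_comp
      (fun z : ℝ => c * (∏ i ∈ range b, (Polynomial.X - Polynomial.C (r i))).eval z) (2 * k) (K₁ - k)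
  have hφK₁ : φ K₁ = c * (∏ i ∈ range b, (Polynomial.X - Polynomial.C (r i))).eval (K₁ : ℝ) := hφ K₁
  rw [laplaceQuarter_iter_eq_fwdDiff_iter, hφK₁, hφfun, hT, abs_mul,
    abs_of_nonneg (by positivity : (0 : ℝ) ≤ (1 / 4 : ℝ) ^ k)]
  push_cast
  -- the far-roots difference bound at the base point `K₁ − k`, window length `2k`
  have hfar2 : ∀ i, i < b → R + ((2 * k : ℕ) : ℝ) ≤ |((K₁ : ℝ) - k) - r i| := by
    intro i hi
    have h := hfar i hi
    have htri : |(K₁ : ℝ) - r i| ≤ |((K₁ : ℝ) - k) - r i| + k := by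
      have e : (K₁ : ℝ) - r i = (((K₁ : ℝ) - k) - r i) + k := by ring
      rw [e]
      calc |(((K₁ : ℝ) - k) - r i) + k| ≤ |((K₁ : ℝ) - k) - r i| + |(k : ℝ)| := abs_add_le _ _
        _ = _ := by rw [Nat.abs_cast]
    push_cast
    linarith
  have hA := Literature.Algebra.Polynomial.RealRootedFarDifferences.abs_fwdDiff_iter_eval_const_mul_prod_le
    r b (2 * k) hR ((K₁ : ℝ) - k) c hfar2
  -- moving the evaluation point back from `K₁ − k` to `K₁`
  have hfar1 : ∀ i, i < b → R + (k : ℝ) ≤ |(K₁ : ℝ) - r i| := fun i hi => by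
    have := hfar i hi; have hk : (0 : ℝ) ≤ k := Nat.cast_nonneg _; linarith
  have hξ : |((K₁ : ℝ) - k) - (K₁ : ℝ)| ≤ k := by
    rw [show (K₁ : ℝ) - k - K₁ = -(k : ℝ) by ring, abs_neg, Nat.abs_cast]
  have hB := Literature.Algebra.Polynomial.RealRootedFarDifferences.abs_eval_prod_le_exp_mul r hR
    (Nat.cast_nonneg k) hξ b hfar1
  have hc0 : 0 ≤ |c| := abs_nonneg c
  have h40 : (0 : ℝ) ≤ (1 / 4 : ℝ) ^ k := by positivity
  calc (1 / 4 : ℝ) ^ k * |(fwdDiff (1 : ℝ))^[2 * k]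
          (fun z : ℝ => c * (∏ i ∈ range b, (Polynomial.X - Polynomial.C (r i))).eval z) ((K₁ : ℝ) - k)|
      ≤ (1 / 4 : ℝ) ^ k * (((b : ℝ) / R) ^ (2 * k) * Real.exp (b * ((2 * k : ℕ) : ℝ) / R) *
          |c * (∏ i ∈ range b, (Polynomial.X - Polynomial.C (r i))).eval ((K₁ : ℝ) - k)|) :=
        mul_le_mul_of_nonneg_left hA h40
    _ = (1 / 4 : ℝ) ^ k * ((b : ℝ) / R) ^ (2 * k) * Real.exp (b * ((2 * k : ℕ) : ℝ) / R) *
          (|c| * |(∏ i ∈ range b, (Polynomial.X - Polynomial.C (r i))).eval ((K₁ : ℝ) - k)|) := by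
        rw [abs_mul]; ring
    _ ≤ (1 / 4 : ℝ) ^ k * ((b : ℝ) / R) ^ (2 * k) * Real.exp (b * ((2 * k : ℕ) : ℝ) / R) *
          (|c| * (Real.exp (b * k / R) *
            |(∏ i ∈ range b, (Polynomial.X - Polynomial.C (r i))).eval (K₁ : ℝ)|)) := by
        gcongr
    _ = _ := by simp only [abs_mul]; push_cast; ring

end BinomialSmoothing

end Literature.Probability.Distributions

end
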